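import Literature.MathematicalPhysics.QuantumFieldTheory.Balaban1983to89.B1TorusCubeChart

/-!
# `Balaban1983to89.B1TorusCubeContours` — the CONTOURS «Γ^{(k)}_{y,x} = Γ_{y,x_{k−1}} ∪ … ∪ Γ_{x₁,x}» of [Balaban1982Higgs1]
# (2.1)–(2.2) p. 608 inside a cube of the (Higgs)₂,₃ torus, AS SITE LISTS on the box carrier of the cell's [B4] lineage
# (`B4GaugeCovariance.transport`, `B4Lower18Regular.{stairL, lsum, PathRel, pathEnd}`), and the identity
# «A(Γ^{(k)}_{y,x}) = Σ_{b⊂Γ} A_b» = `HiggsAveraging.multiContourSum` along the cube chart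

statement-level skeleton of published theorems with citation tags; proofs where landed; nothing here is a claim about the Yang–Mills mass gap

CITATION HEADER (lean-in-tree rule).  T. Bałaban, *(Higgs)₂,₃ quantum fields in a finite volume. I*, Commun. Math. Phys. **85**
(1982) 603–626 [Balaban1982Higgs1] ((2.1)–(2.3) p. 608: the staircase `Γ_{y,x}`, the composite contour `Γ^{(k)}_{y,x}`, `A(Γ) =
Σ_{b⊂Γ} A_b`) and T. Bałaban, *Regularity and decay of lattice Green's functions*, Commun. Math. Phys. **89** (1983) 571–597
[Balaban1983RegularityDecay] ((1.4) p. 572 «U(A(Γ^{(k)}_{y,x}))»).  Cell `lit-balaban`, Phase-2 proof seat **p35** gen 8 (unit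
`lit-balaban-p35`); SKELETON rows **B1.Eq2.2** (the contour as data) feeding **B4.Thm@573**/(1.10) on the torus.  USED BY NAME,
never restated: `HiggsAveraging.{segSum, corner, contourSum, multiContourSum, multiContourSum_succ, multiContourSum_zero, shiftN,
blockIter, toFinest}`, r01's `B4Lower18Regular.{e1, seg, raise, stairL, lsum, PathRel, pathEnd, pathEnd_append, pathRel_append,
pathEnd_stairL, pathRel_stairL, mem_stairL, length_seg, pathEnd_seg, val_pathEnd_pmap, pathRel_pmap_iff}`, b04's
`B4Reflection242.{boxDom, nbrs, blk}`, this seat's `B1TorusCubeChart`.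

WHAT IS PRINTED (p. 608, verbatim up to OCR).  *«Let us define Γ_{y,x} as the following contour: Γ_{y,x} = ⟨y, (y₁,…,y_{d−1},x_d)⟩
∪ ⟨(y₁,…,y_{d−1},x_d), (y₁,…,y_{d−2},x_{d−1},x_d)⟩ ∪ … ∪ ⟨(y₁,x₂,…,x_d), x⟩. (2.1) … Γ^{(k)}_{y,x} = Γ_{y,x_{k−1}} ∪ Γ_{x_{k−1},x_{k−2}}
∪ … ∪ Γ_{x₁,x}. (2.2) … A(Γ) = Σ_{b⊂Γ} A_b (2.3)»* — the coordinates are adjusted in the order `d, d−1, …, 1`.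

WHAT THIS FILE PROVES (kernel-checked, zero `sorry`; definitions with bodies + theorems; no `def … : Prop` fact).
* §1 list calculus: `lsum_append`, `lsum_pmap`, `lsum_seg`.
* §2 `cornerZ` (the corners `(y₁,…,y_t,x_{t+1},…)`), `revDirs` (directions `t−1, …, 0`), `stairL_revDirs_succ`,
  `lsum_stairL_revDirs` / `length_stairL_revDirs` (the staircase through `revDirs` as an explicit double sum).
* §3 `clv i y = Lⁱ⌊y/Lⁱ⌋`, `mlist K y` (the composite contour (2.2) from the `K`-block corner to `y` as a site list):
  `pathEnd_mlist`, `pathRel_mlist`, `mem_mlist_bounds`, `length_mlist_le` (`≤ Σ_μ (y_μ mod L^K) ≤ d(L^K − 1)`), `lsum_mlist`.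
* §4 THE DICTIONARY: `contourSum_toT` (B1's `A(Γ_{Y,X})` along the chart = the explicit double sum), **`lsum_mlist_eq_multiContourSum`**
  (for a pair function `B` with `B(z, z + e_i) = σ·Ã(⟨toT z, i⟩)` on the box: `lsum B (clv K y) (mlist K y) = σ·Ã(Γ^{(K)}_{·,toT y})`).
* §5 the contour SYSTEM `gammaT` on the lineage's subtypes (`baseEmb` start, `mlist` body when `x ∈ B(y)`, else empty):
  `gammaT_end`, `gammaT_nn`, `length_gammaT_le`, `lsum_gammaT`.
HONEST SCOPE.  Combinatorics of (2.1)–(2.2) only (`K ≤ K_P`).  Unit `lit-balaban-p35` gen 8 (literature-prover-lit-balaban-p35-g8-0).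
-/

open scoped BigOperators

noncomputable section

namespace Literature.MathematicalPhysics.QuantumFieldTheory.Balaban1983to89.B1TorusCubeContours

open Literature.MathematicalPhysics.QuantumFieldTheory.Balaban1983to89.HiggsLattice
open Literature.MathematicalPhysics.QuantumFieldTheory.Balaban1983to89.HiggsAveraging
open Literature.MathematicalPhysics.QuantumFieldTheory.Balaban1983to89.B2Ineq329ZeroAveraging
  (shiftN_apply_self shiftN_apply_ne)
open Literature.MathematicalPhysics.QuantumFieldTheory.Balaban1983to89.B1TorusCubeCover
open Literature.MathematicalPhysics.QuantumFieldTheory.Balaban1983to89.B1TorusCubeChart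
open Literature.MathematicalPhysics.QuantumFieldTheory.Balaban1983to89.B4Reflection242 (boxDom mem_boxDom blk nbrs)
open Literature.MathematicalPhysics.QuantumFieldTheory.Balaban1983to89.B4GaugeCovariance (pathEnd)
open Literature.MathematicalPhysics.QuantumFieldTheory.Balaban1983to89.B4Lower18Regular (e1 e1_apply_self e1_apply_ne
  add_nsmul_e1_apply seg length_seg pathEnd_seg raise raise_apply_self raise_apply_ne le_raise raise_le stairL lsum PathRel
  pathEnd_append pathRel_append pathEnd_stairL pathRel_stairL mem_stairL val_pathEnd_pmap pathRel_pmap_iff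
  baseEmb mem_boxDom_of_between)
open Literature.MathematicalPhysics.QuantumFieldTheory.Balaban1983to89.B4Lemma22ReduceZero (Box)

variable {P : HiggsLattice.Params}

/-! ## §1 List calculus for `A(Γ) = Σ_{b⊂Γ} A_b` -/

section Lists

variable {X : Type*}

/-- `A(Γ₁ ∪ Γ₂) = A(Γ₁) + A(Γ₂)` for concatenated contours. [cite: Balaban1982Higgs1, (2.3) p.608] -/
theorem lsum_append (B : X → X → ℝ) (x : X) (l₁ l₂ : List X) :
    lsum B x (l₁ ++ l₂) = lsum B x l₁ + lsum B (pathEnd x l₁) l₂ := by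
  induction l₁ generalizing x with
  | nil => simp [lsum, pathEnd]
  | cons y l ih => simp [lsum, pathEnd, ih, add_assoc]

/-- `A(Γ)` along a contour transported into a subtype is `A(Γ)`. [cite: Balaban1983RegularityDecay, (1.4) p.572] -/
theorem lsum_pmap {Q : X → Prop} (B : X → X → ℝ) (l : List X) (p : X) (hp : Q p) (h : ∀ z ∈ l, Q z) :
    lsum (fun u v : Subtype Q => B u.1 v.1) ⟨p, hp⟩ (l.pmap Subtype.mk h) = lsum B p l := by
  induction l generalizing p with
  | nil => rfl
  | cons a l ih =>
      simp only [List.pmap, lsum]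
      rw [ih a (h a (by simp))]

end Lists

section Segments

variable {d : ℕ}

/-- `A` along a straight segment of `m` steps: `Σ_{s<m} A(p + se_i, p + (s+1)e_i)`. [cite: Balaban1982Higgs1, (2.3) p.608] -/
theorem lsum_seg (B : (Fin (d + 1) → ℤ) → (Fin (d + 1) → ℤ) → ℝ) (i : Fin (d + 1)) (m : ℕ) :
    ∀ p, lsum B p (seg i p m) = ∑ s ∈ Finset.range m, B (p + s • e1 i) (p + (s + 1) • e1 i) := by
  induction m with
  | zero => intro p; simp [seg, lsum]
  | succ m ih =>
      intro p
      rw [seg, lsum, ih (p + e1 i), Finset.sum_range_succ' _ m]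
      simp only [zero_smul, add_zero, zero_add, one_smul, add_smul, add_assoc, add_comm (e1 i) ((_ : ℕ) • e1 i)]
      ring

end Segments

/-! ## §2 The staircase (2.1) through the directions `d, d−1, …, 1` as an explicit double sum -/

section Stair

variable {d : ℕ}

/-- The corners of (2.1): `cornerZ Y X t = (y₁, …, y_t, x_{t+1}, …, x_d)` (coordinates `< t` from `Y`, the rest from `X`).
[cite: Balaban1982Higgs1, (2.1) p.608] -/
def cornerZ (Y X : Fin (d + 1) → ℤ) (t : ℕ) : Fin (d + 1) → ℤ := fun μ => if (μ : ℕ) < t then Y μ else X μ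

/-- `cornerZ Y X 0 = X`. [cite: Balaban1982Higgs1, (2.1) p.608] -/
theorem cornerZ_zero (Y X : Fin (d + 1) → ℤ) : cornerZ Y X 0 = X := by
  funext μ; simp [cornerZ]

/-- `cornerZ Y X (d+1) = Y`. [cite: Balaban1982Higgs1, (2.1) p.608] -/
theorem cornerZ_top (Y X : Fin (d + 1) → ℤ) : cornerZ Y X (d + 1) = Y := by
  funext μ; simp [cornerZ, μ.isLt]

/-- The directions `t−1, t−2, …, 0` (the print adjusts the coordinates «in the order d, d−1, …, 1»).
[cite: Balaban1982Higgs1, (2.1) p.608] -/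
def revDirs (d : ℕ) : (t : ℕ) → t ≤ d + 1 → List (Fin (d + 1))
  | 0, _ => []
  | t + 1, h => ⟨t, h⟩ :: revDirs d t (Nat.le_of_succ_le h)

/-- Every direction occurs in `revDirs (d+1)`. [cite: Balaban1982Higgs1, (2.2) p.608] -/
theorem mem_revDirs {t : ℕ} (ht : t ≤ d + 1) (i : Fin (d + 1)) (hi : (i : ℕ) < t) : i ∈ revDirs d t ht := by
  induction t with
  | zero => exact absurd hi (Nat.not_lt_zero _)
  | succ t ih =>
      simp only [revDirs, List.mem_cons]
      by_cases h : (i : ℕ) = t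
      · left; exact Fin.ext h
      · right; exact ih (Nat.le_of_succ_le ht) (by omega)

/-- `revDirs t` has length `t`. [cite: Balaban1982Higgs1, (2.2) p.608] -/
theorem length_revDirs {t : ℕ} (ht : t ≤ d + 1) : (revDirs d t ht).length = t := by
  induction t with
  | zero => rfl
  | succ t ih => simp [revDirs, ih]

/-- Raising coordinate `t` of the corner `cornerZ Y X (t+1)` to `X` gives the corner `cornerZ Y X t` (`Y ≤ X`).
[cite: Balaban1982Higgs1, (2.1) p.608] -/
theorem raise_cornerZ {Y X : Fin (d + 1) → ℤ} (hYX : Y ≤ X) {t : ℕ} (ht : t < d + 1) :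
    raise X (cornerZ Y X (t + 1)) ⟨t, ht⟩ = cornerZ Y X t := by
  have hle : cornerZ Y X (t + 1) ≤ X := fun μ => by
    unfold cornerZ; split_ifs
    · exact hYX μ
    · exact le_rfl
  funext μ
  by_cases hμ : μ = ⟨t, ht⟩
  · subst hμ
    rw [raise_apply_self hle]
    simp [cornerZ]
  · rw [raise_apply_ne X _ hμ]
    have : (μ : ℕ) ≠ t := fun h => hμ (Fin.ext h)
    simp only [cornerZ]
    split_ifs <;> first | rfl | omega

/-- One step of the staircase through `revDirs`: the segment in direction `t`, then the rest.
[cite: Balaban1982Higgs1, (2.1) p.608] -/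
theorem stairL_revDirs_succ {Y X : Fin (d + 1) → ℤ} (hYX : Y ≤ X) {t : ℕ} (ht : t + 1 ≤ d + 1) :
    stairL X (cornerZ Y X (t + 1)) (revDirs d (t + 1) ht)
      = seg ⟨t, ht⟩ (cornerZ Y X (t + 1)) (X ⟨t, ht⟩ - Y ⟨t, ht⟩).toNat
        ++ stairL X (cornerZ Y X t) (revDirs d t (Nat.le_of_succ_le ht)) := by
  have e : revDirs d (t + 1) ht = ⟨t, ht⟩ :: revDirs d t (Nat.le_of_succ_le ht) := rfl
  rw [e, stairL, raise_cornerZ hYX ht]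
  simp [cornerZ]

/-- **THE STAIRCASE (2.1) AS A DOUBLE SUM**: `A(Γ_{Y,X}) = Σ_{t<T} Σ_{s<m_t} A(c_t + se_t, c_t + (s+1)e_t)`, `c_t = cornerZ Y X (t+1)`,
`m_t = X_t − Y_t`, for the part through the directions `< T`. [cite: Balaban1982Higgs1, (2.1)–(2.3) p.608] -/
theorem lsum_stairL_revDirs (B : (Fin (d + 1) → ℤ) → (Fin (d + 1) → ℤ) → ℝ) {Y X : Fin (d + 1) → ℤ} (hYX : Y ≤ X) :
    ∀ (t : ℕ) (ht : t ≤ d + 1),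
      lsum B (cornerZ Y X t) (stairL X (cornerZ Y X t) (revDirs d t ht))
        = ∑ i ∈ (Finset.univ : Finset (Fin (d + 1))).filter (fun i : Fin (d + 1) => i.val < t),
            ∑ s ∈ Finset.range (X i - Y i).toNat,
              B (cornerZ Y X (i + 1) + s • e1 i) (cornerZ Y X (i + 1) + (s + 1) • e1 i) := by
  intro t
  induction t with
  | zero => intro ht; simp [revDirs, stairL, lsum]
  | succ t ih =>
      intro ht
      rw [stairL_revDirs_succ hYX ht, lsum_append, lsum_seg, pathEnd_seg]
      have hend : cornerZ Y X (t + 1) + (X ⟨t, ht⟩ - Y ⟨t, ht⟩).toNat • e1 ⟨t, ht⟩ = cornerZ Y X t := by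
        rw [← raise_cornerZ hYX ht]; simp [raise, cornerZ]
      rw [hend, ih (Nat.le_of_succ_le ht)]
      have hsplit : (Finset.univ : Finset (Fin (d + 1))).filter (fun i : Fin (d + 1) => i.val < t + 1)
          = insert ⟨t, ht⟩ ((Finset.univ : Finset (Fin (d + 1))).filter (fun i : Fin (d + 1) => i.val < t)) := by
        ext i
        simp only [Finset.mem_filter, Finset.mem_univ, true_and, Finset.mem_insert]
        constructor
        · intro h
          by_cases hi : (i : ℕ) = t
          · left; exact Fin.ext hi
          · right; omega
        · rintro (rfl | h)
          · exact Nat.lt_succ_self _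
          · omega
      rw [hsplit, Finset.sum_insert (by simp)]

/-- **THE LENGTH OF THE STAIRCASE**: `|Γ_{Y,X}| = Σ_{t<T} m_t` for the part through the directions `< T`.
[cite: Balaban1982Higgs1, (2.1) p.608] -/
theorem length_stairL_revDirs {Y X : Fin (d + 1) → ℤ} (hYX : Y ≤ X) :
    ∀ (t : ℕ) (ht : t ≤ d + 1),
      ((stairL X (cornerZ Y X t) (revDirs d t ht)).length : ℤ)
        = ∑ i ∈ (Finset.univ : Finset (Fin (d + 1))).filter (fun i : Fin (d + 1) => i.val < t), (X i - Y i) := by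
  intro t
  induction t with
  | zero => intro ht; simp [revDirs, stairL]
  | succ t ih =>
      intro ht
      rw [stairL_revDirs_succ hYX ht, List.length_append, length_seg, Nat.cast_add, ih (Nat.le_of_succ_le ht),
        Int.toNat_of_nonneg (sub_nonneg.2 (hYX _))]
      have hsplit : (Finset.univ : Finset (Fin (d + 1))).filter (fun i : Fin (d + 1) => i.val < t + 1)
          = insert ⟨t, ht⟩ ((Finset.univ : Finset (Fin (d + 1))).filter (fun i : Fin (d + 1) => i.val < t)) := by
        ext i
        simp only [Finset.mem_filter, Finset.mem_univ, true_and, Finset.mem_insert]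
        constructor
        · intro h
          by_cases hi : (i : ℕ) = t
          · left; exact Fin.ext hi
          · right; omega
        · rintro (rfl | h)
          · exact Nat.lt_succ_self _
          · omega
      rw [hsplit, Finset.sum_insert (by simp)]

/-- The full staircase `Γ_{Y,X}` from `Y` (all directions): the filter is everything. [cite: Balaban1982Higgs1, (2.1) p.608] -/
theorem filter_lt_top : (Finset.univ : Finset (Fin (d + 1))).filter (fun i : Fin (d + 1) => i.val < d + 1) = Finset.univ := by
  ext i; simp only [Finset.mem_filter, Finset.mem_univ, true_and, iff_true]; exact i.isLt

end Stair

/-! ## §3 The composite contour (2.2) inside a cube: block corners `Lⁱ⌊y/Lⁱ⌋` and the list `mlist` -/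

section Composite

variable {d : ℕ}

/-- The corner of the `Lⁱ`-block of `y` (box coordinates): `clv L i y = Lⁱ⌊y/Lⁱ⌋` coordinatewise.
[cite: Balaban1982Higgs1, (2.2) p.608] -/
def clv (L : ℕ) (i : ℕ) (y : Fin (d + 1) → ℤ) : Fin (d + 1) → ℤ := fun μ => (L : ℤ) ^ i * (y μ / (L : ℤ) ^ i)

/-- `clv L 0 y = y`. [cite: Balaban1982Higgs1, (2.2) p.608] -/
theorem clv_zero (L : ℕ) (y : Fin (d + 1) → ℤ) : clv L 0 y = y := by
  funext μ; simp [clv]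

/-- `Lⁱ⌊y/Lⁱ⌋ ≤ y`. [cite: Balaban1982Higgs1, (2.2) p.608] -/
theorem clv_le {L : ℕ} (hL : 0 < L) (i : ℕ) (y : Fin (d + 1) → ℤ) : clv L i y ≤ y := fun μ => by
  unfold clv
  have hLi : (0 : ℤ) < (L : ℤ) ^ i := by positivity
  rw [mul_comm]
  exact Int.ediv_mul_le _ hLi.ne'

/-- `0 ≤ y ⇒ 0 ≤ Lⁱ⌊y/Lⁱ⌋`. [cite: Balaban1982Higgs1, (2.2) p.608] -/
theorem clv_nonneg {L : ℕ} (hL : 0 < L) (i : ℕ) {y : Fin (d + 1) → ℤ} (hy : 0 ≤ y) : 0 ≤ clv L i y := fun μ => by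
  unfold clv
  have hLi : (0 : ℤ) < (L : ℤ) ^ i := by positivity
  exact mul_nonneg hLi.le (Int.ediv_nonneg (hy μ) hLi.le)

/-- The coarser corner is below the finer one: `Lⁱ⁺¹⌊y/Lⁱ⁺¹⌋ ≤ Lⁱ⌊y/Lⁱ⌋`. [cite: Balaban1982Higgs1, (2.2) p.608] -/
theorem clv_succ_le {L : ℕ} (hL : 0 < L) (i : ℕ) (y : Fin (d + 1) → ℤ) : clv L (i + 1) y ≤ clv L i y := fun μ => by
  unfold clv
  have hLi : (0 : ℤ) < (L : ℤ) ^ i := by positivity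
  have hL1 : (0 : ℤ) < (L : ℤ) := by exact_mod_cast hL
  -- `L^{i+1}⌊y/L^{i+1}⌋ = Lⁱ·(L⌊y/L^{i+1}⌋)` and `L⌊y/L^{i+1}⌋ ≤ ⌊y/Lⁱ⌋`
  have key : (L : ℤ) * (y μ / (L : ℤ) ^ (i + 1)) ≤ y μ / (L : ℤ) ^ i := by
    rw [Int.le_ediv_iff_mul_le hLi]
    calc (L : ℤ) * (y μ / (L : ℤ) ^ (i + 1)) * (L : ℤ) ^ i = (y μ / (L : ℤ) ^ (i + 1)) * (L : ℤ) ^ (i + 1) := by ring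
      _ ≤ y μ := Int.ediv_mul_le _ (by positivity)
  calc (L : ℤ) ^ (i + 1) * (y μ / (L : ℤ) ^ (i + 1)) = (L : ℤ) ^ i * ((L : ℤ) * (y μ / (L : ℤ) ^ (i + 1))) := by ring
    _ ≤ (L : ℤ) ^ i * (y μ / (L : ℤ) ^ i) := mul_le_mul_of_nonneg_left key hLi.le

/-- The displacement of the level-`i` staircase: `Lⁱ⌊y/Lⁱ⌋ − Lⁱ⁺¹⌊y/Lⁱ⁺¹⌋ = (y mod Lⁱ⁺¹) − (y mod Lⁱ)`. [cite: Balaban1982Higgs1, (2.2) p.608] -/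
theorem clv_sub_clv_succ (L : ℕ) (i : ℕ) (y : Fin (d + 1) → ℤ) (μ : Fin (d + 1)) :
    clv L i y μ - clv L (i + 1) y μ = y μ % (L : ℤ) ^ (i + 1) - y μ % (L : ℤ) ^ i := by
  unfold clv
  rw [Int.emod_def, Int.emod_def]
  ring

/-- **THE COMPOSITE CONTOUR (2.2) AS A SITE LIST**: from the corner of the `L^i`-block of `y` down to `y`, the staircase (2.1)
from `Lⁱ⌊y/Lⁱ⌋` to `Lⁱ⁻¹⌊y/Lⁱ⁻¹⌋` first, then the one to `Lⁱ⁻²⌊…⌋`, …, last the one to `y`. [cite: Balaban1982Higgs1, (2.2) p.608] -/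
def mlist (L : ℕ) : ℕ → (Fin (d + 1) → ℤ) → List (Fin (d + 1) → ℤ)
  | 0, _ => []
  | i + 1, y => stairL (clv L i y) (clv L (i + 1) y) (revDirs d (d + 1) le_rfl) ++ mlist L i y

/-- The composite contour ends at `y`. [cite: Balaban1982Higgs1, (2.2) p.608] -/
theorem pathEnd_mlist {L : ℕ} (hL : 0 < L) (y : Fin (d + 1) → ℤ) :
    ∀ i, pathEnd (clv L i y) (mlist L i y) = y := by
  intro i
  induction i with
  | zero => simp [mlist, pathEnd, clv_zero]
  | succ i ih =>
      rw [mlist, pathEnd_append, pathEnd_stairL _ _ _ (clv_succ_le hL i y)]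
      have : (fun j => if j ∈ revDirs d (d + 1) le_rfl then clv L i y j else clv L (i + 1) y j) = clv L i y := by
        funext j; rw [if_pos (mem_revDirs le_rfl j j.isLt)]
      rw [this, ih]

/-- The composite contour is a nearest-neighbour path. [cite: Balaban1982Higgs1, (2.2) p.608] -/
theorem pathRel_mlist {L : ℕ} (hL : 0 < L) (y : Fin (d + 1) → ℤ) :
    ∀ i, PathRel (fun u v => v ∈ nbrs u) (clv L i y) (mlist L i y) := by
  intro i
  induction i with
  | zero => trivial
  | succ i ih =>
      rw [mlist, pathRel_append, pathEnd_stairL _ _ _ (clv_succ_le hL i y)]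
      have : (fun j => if j ∈ revDirs d (d + 1) le_rfl then clv L i y j else clv L (i + 1) y j) = clv L i y := by
        funext j; rw [if_pos (mem_revDirs le_rfl j j.isLt)]
      rw [this]
      exact ⟨pathRel_stairL _ _ _ (clv_succ_le hL i y), ih⟩

/-- The composite contour stays between the block corner and `y`. [cite: Balaban1982Higgs1, (2.2) p.608] -/
theorem mem_mlist_bounds {L : ℕ} (hL : 0 < L) (y : Fin (d + 1) → ℤ) :
    ∀ i, ∀ z ∈ mlist L i y, clv L i y ≤ z ∧ z ≤ y := by
  intro i
  induction i with
  | zero => intro z hz; simp [mlist] at hz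
  | succ i ih =>
      intro z hz
      rw [mlist, List.mem_append] at hz
      rcases hz with hz | hz
      · have h := mem_stairL (u := clv L (i + 1) y) (x := clv L i y) _ _ le_rfl (clv_succ_le hL i y) z hz
        exact ⟨h.1, h.2.trans (clv_le hL i y)⟩
      · have h := ih z hz
        exact ⟨(clv_succ_le hL i y).trans h.1, h.2⟩

/-- **THE LENGTH OF `Γ^{(K)}`** is `Σ_μ ((y_μ mod L^K) − (y_μ mod 1)) = Σ_μ (y_μ mod L^K)` — less than `d·L^K`.
[cite: Balaban1982Higgs1, (2.2) p.608] -/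
theorem length_mlist {L : ℕ} (hL : 0 < L) (y : Fin (d + 1) → ℤ) :
    ∀ i, ((mlist L i y).length : ℤ) = ∑ μ, y μ % (L : ℤ) ^ i := by
  intro i
  induction i with
  | zero => simp [mlist]
  | succ i ih =>
      rw [mlist, List.length_append, Nat.cast_add, ih]
      have h := length_stairL_revDirs (Y := clv L (i + 1) y) (X := clv L i y) (clv_succ_le hL i y) (d + 1) le_rfl
      rw [cornerZ_top] at h
      rw [h, filter_lt_top, ← Finset.sum_add_distrib]
      refine Finset.sum_congr rfl fun μ _ => ?_
      rw [clv_sub_clv_succ]; ring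

/-- `|Γ^{(K)}_{·,y}| ≤ (d+1)(L^K − 1)`. [cite: Balaban1982Higgs1, (2.2) p.608] -/
theorem length_mlist_le {L : ℕ} (hL : 0 < L) (y : Fin (d + 1) → ℤ) (i : ℕ) :
    ((mlist L i y).length : ℤ) ≤ ((d : ℤ) + 1) * ((L : ℤ) ^ i - 1) := by
  rw [length_mlist hL y i]
  have hLi : (0 : ℤ) < (L : ℤ) ^ i := by positivity
  calc ∑ μ, y μ % (L : ℤ) ^ i ≤ ∑ _μ : Fin (d + 1), ((L : ℤ) ^ i - 1) :=
        Finset.sum_le_sum fun μ _ => by have := Int.emod_lt_of_pos (y μ) hLi; omega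
    _ = ((d : ℤ) + 1) * ((L : ℤ) ^ i - 1) := by
        rw [Finset.sum_const, Finset.card_univ, Fintype.card_fin, nsmul_eq_mul]; push_cast; ring

/-- **`A(Γ^{(i)})` AS A SUM OVER THE PIECES**: `lsum B (clv i y) (mlist i y) = Σ_{i'<i} lsum B (clv (i'+1) y) (stair to clv i' y)`.
[cite: Balaban1982Higgs1, (2.2)–(2.3) p.608] -/
theorem lsum_mlist {L : ℕ} (hL : 0 < L) (B : (Fin (d + 1) → ℤ) → (Fin (d + 1) → ℤ) → ℝ) (y : Fin (d + 1) → ℤ) :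
    ∀ i, lsum B (clv L i y) (mlist L i y)
      = ∑ i' ∈ Finset.range i, lsum B (clv L (i' + 1) y) (stairL (clv L i' y) (clv L (i' + 1) y) (revDirs d (d + 1) le_rfl)) := by
  intro i
  induction i with
  | zero => simp [mlist, lsum]
  | succ i ih =>
      rw [mlist, lsum_append, pathEnd_stairL _ _ _ (clv_succ_le hL i y)]
      have : (fun j => if j ∈ revDirs d (d + 1) le_rfl then clv L i y j else clv L (i + 1) y j) = clv L i y := by
        funext j; rw [if_pos (mem_revDirs le_rfl j j.isLt)]
      rw [this, ih, Finset.sum_range_succ, add_comm]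

end Composite

/-! ## §4 The dictionary with B1's `contourSum` / `multiContourSum` along the cube chart -/

section Dictionary

variable {K K₀ : ℕ}

/-- B1's corner of (2.1) along the chart: `corner (toT Y) (toT X) (castD i) = toT (cornerZ Y X (i+1))`.
[cite: Balaban1982Higgs1, (2.1) p.608] -/
theorem corner_toT (j : Lab P K K₀) (Y X : Fin (dd P + 1) → ℤ) (i : Fin (dd P + 1)) :
    corner (toT K K₀ j Y) (toT K K₀ j X) (castD P i) = toT K K₀ j (cornerZ Y X (i + 1)) := by
  funext μ
  unfold corner toT chart vecT cornerZ
  have hμ : (μ ≤ castD P i) ↔ ((((castD P).symm μ : Fin (dd P + 1)) : ℕ) < (i : ℕ) + 1) := by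
    rw [Fin.le_iff_val_le_val, castD_val, castD_symm_val]; omega
  by_cases h : μ ≤ castD P i
  · rw [if_pos h, if_pos (hμ.1 h)]
  · rw [if_neg h, if_neg (fun h' => h (hμ.2 h'))]

/-- The number of steps of B1's segment along the chart: `val(toT X_ν − toT Y_ν) = X_i − Y_i` for `0 ≤ X_i − Y_i < |T_ε|_ν`.
[cite: Balaban1982Higgs1, (2.1) p.608] -/
theorem val_toT_sub (j : Lab P K K₀) (Y X : Fin (dd P + 1) → ℤ) (i : Fin (dd P + 1))
    (h0 : 0 ≤ X i - Y i) (h1 : X i - Y i < P.sitesPerDir 0 (castD P i)) :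
    ((toT K K₀ j X (castD P i) - toT K K₀ j Y (castD P i)).val : ℕ) = (X i - Y i).toNat := by
  have e : toT K K₀ j X (castD P i) - toT K K₀ j Y (castD P i) = ((X i - Y i : ℤ) : ZMod (P.sitesPerDir 0 (castD P i))) := by
    unfold toT chart; rw [vecT_castD, vecT_castD]; push_cast; ring
  rw [e]
  have := ZMod.val_intCast (n := P.sitesPerDir 0 (castD P i)) (X i - Y i)
  rw [Int.emod_eq_of_lt h0 h1] at this
  have h2 : (((X i - Y i).toNat : ℕ) : ℤ) = X i - Y i := Int.toNat_of_nonneg h0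
  exact_mod_cast this.trans h2.symm

/-- **B1's `A(Γ_{Y,X})` ALONG THE CHART AS A DOUBLE SUM**: for `Y ≤ X` with `X − Y` below the torus sides,
`contourSum Ã (toT Y) (toT X) = Σ_i Σ_{s<X_i−Y_i} Ã(⟨toT(cornerZ Y X (i+1) + se_i), castD i⟩)`.
[cite: Balaban1982Higgs1, (2.1)–(2.3) p.608] -/
theorem contourSum_toT (j : Lab P K K₀) (At : HiggsLattice.VecField P 0) {Y X : Fin (dd P + 1) → ℤ} (hYX : Y ≤ X)
    (hlt : ∀ i, X i - Y i < P.sitesPerDir 0 (castD P i)) :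
    contourSum At (toT K K₀ j Y) (toT K K₀ j X)
      = ∑ i : Fin (dd P + 1), ∑ s ∈ Finset.range (X i - Y i).toNat,
          At ⟨toT K K₀ j (cornerZ Y X (i + 1) + s • e1 i), castD P i⟩ := by
  unfold contourSum
  rw [← (castD P).sum_comp]
  refine Finset.sum_congr rfl fun i _ => ?_
  unfold segSum
  rw [corner_toT, val_toT_sub j Y X i (sub_nonneg.2 (hYX i)) (hlt i)]
  refine Finset.sum_congr rfl fun s _ => ?_
  rw [toT_add_nsmul]

/-- **THE DICTIONARY FOR ONE STAIRCASE**: if `B(z, z + e_i) = σ·Ã(⟨toT z, castD i⟩)` for all `z` between `Y` and `X`, then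
`lsum B Y Γ_{Y,X} = σ·contourSum Ã (toT Y) (toT X)`. [cite: Balaban1982Higgs1, (2.1)–(2.3) p.608] -/
theorem lsum_stair_eq_contourSum (j : Lab P K K₀) (At : HiggsLattice.VecField P 0) (σ : ℝ)
    (B : (Fin (dd P + 1) → ℤ) → (Fin (dd P + 1) → ℤ) → ℝ) {Y X : Fin (dd P + 1) → ℤ} (hYX : Y ≤ X)
    (hlt : ∀ i, X i - Y i < P.sitesPerDir 0 (castD P i))
    (hB : ∀ z, Y ≤ z → z ≤ X → ∀ i, B z (z + e1 i) = σ * At ⟨toT K K₀ j z, castD P i⟩) :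
    lsum B Y (stairL X Y (revDirs (dd P) (dd P + 1) le_rfl)) = σ * contourSum At (toT K K₀ j Y) (toT K K₀ j X) := by
  have h := lsum_stairL_revDirs B hYX (dd P + 1) le_rfl
  rw [cornerZ_top] at h
  rw [h, filter_lt_top, contourSum_toT j At hYX hlt, Finset.mul_sum]
  refine Finset.sum_congr rfl fun i _ => ?_
  rw [Finset.mul_sum]
  refine Finset.sum_congr rfl fun s hs => ?_
  rw [Finset.mem_range] at hs
  have e : cornerZ Y X (i + 1) + (s + 1) • e1 i = (cornerZ Y X (i + 1) + s • e1 i) + e1 i := by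
    rw [add_smul, one_smul, add_assoc]
  rw [e]
  refine hB _ (fun μ => ?_) (fun μ => ?_) i
  · rw [add_nsmul_e1_apply]
    unfold cornerZ
    split_ifs <;> linarith [hYX μ]
  · rw [add_nsmul_e1_apply]
    have hs' : (s : ℤ) < X i - Y i := by
      have : (s : ℤ) < ((X i - Y i).toNat : ℤ) := by exact_mod_cast hs
      rwa [Int.toNat_of_nonneg (sub_nonneg.2 (hYX i))] at this
    unfold cornerZ
    by_cases h1 : μ = i
    · subst h1
      rw [if_pos rfl, if_pos (Nat.lt_succ_self _)]; linarith
    · rw [if_neg h1]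
      split_ifs
      · exact hYX μ
      · exact le_rfl

/-- **THE DICTIONARY FOR THE COMPOSITE CONTOUR (2.2)**: if `B(z, z + e_i) = σ·Ã(⟨toT z, castD i⟩)` for all `z` between the
`K`-block corner of `y` and `y`, then `lsum B (clv K y) (mlist K y) = σ·Ã(Γ^{(K)}_{y_K, toT y})` (`K ≤ K_P`; the torus sides
exceed `L^K`). [cite: Balaban1982Higgs1, (2.2)–(2.3) p.608] -/
theorem lsum_mlist_eq_multiContourSum (hK : K ≤ P.K) (hS : ∀ μ, P.L ^ K ≤ P.sitesPerDir 0 μ) (j : Lab P K K₀)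
    (At : HiggsLattice.VecField P 0) (σ : ℝ) (B : (Fin (dd P + 1) → ℤ) → (Fin (dd P + 1) → ℤ) → ℝ) (y : Fin (dd P + 1) → ℤ)
    (hB : ∀ z, clv P.L K y ≤ z → z ≤ y → ∀ i, B z (z + e1 i) = σ * At ⟨toT K K₀ j z, castD P i⟩) :
    lsum B (clv P.L K y) (mlist P.L K y) = σ * multiContourSum At K (toT K K₀ j y) := by
  have hL := P.hL
  -- piecewise, by induction on the number of levels `i ≤ K`
  suffices h : ∀ i, i ≤ K → lsum B (clv P.L i y) (mlist P.L i y) = σ * multiContourSum At i (toT K K₀ j y) from h K le_rfl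
  intro i
  induction i with
  | zero => intro _; simp [mlist, lsum, multiContourSum_zero]
  | succ i ih =>
      intro hi
      rw [mlist, lsum_append, pathEnd_stairL _ _ _ (clv_succ_le hL i y)]
      have e : (fun j' => if j' ∈ revDirs (dd P) (dd P + 1) le_rfl then clv P.L i y j' else clv P.L (i + 1) y j')
          = clv P.L i y := by
        funext j'; rw [if_pos (mem_revDirs le_rfl j' j'.isLt)]
      rw [e, ih (Nat.le_of_succ_le hi), multiContourSum_succ, mul_add, add_comm]
      congr 1
      rw [toFinest_blockIter_toT hK hi, toFinest_blockIter_toT hK (Nat.le_of_succ_le hi)]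
      refine lsum_stair_eq_contourSum j At σ B (clv_succ_le hL i y) (fun i' => ?_) (fun z hz1 hz2 i' => ?_)
      · -- the displacement is `< L^{i+1} ≤ L^K ≤ |T_ε|`
        have h1 : clv P.L i y i' - clv P.L (i + 1) y i' < (P.L : ℤ) ^ (i + 1) := by
          rw [clv_sub_clv_succ]
          have := Int.emod_lt_of_pos (y i') (show (0 : ℤ) < (P.L : ℤ) ^ (i + 1) by positivity)
          have := Int.emod_nonneg (y i') (show ((P.L : ℤ) ^ i) ≠ 0 by positivity)
          linarith
        have h2 : (P.L : ℤ) ^ (i + 1) ≤ (P.L : ℤ) ^ K := pow_le_pow_right₀ (by exact_mod_cast hL) hi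
        have h3 : ((P.L : ℤ) ^ K) ≤ P.sitesPerDir 0 (castD P i') := by exact_mod_cast hS _
        unfold clv at h1 ⊢
        linarith
      · refine hB z (fun μ => le_trans ?_ (hz1 μ)) (fun μ => (hz2 μ).trans (clv_le hL i y μ)) i'
        -- `clv K ≤ clv (i+1)` since `i + 1 ≤ K`
        clear hz1 hz2 e ih
        have : ∀ a b : ℕ, a ≤ b → clv P.L b y μ ≤ clv P.L a y μ := by
          intro a b hab
          induction hab with
          | refl => exact le_rfl
          | step h ih' => exact (clv_succ_le hL _ y μ).trans ih'
        exact this _ _ hi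

end Dictionary

/-! ## §5 The contour system on the lineage's subtypes -/

section System

variable {K K₀ : ℕ}

/-- For `x ∈ □` every site of `Γ^{(K)}_{·,x}` lies in `□`. [cite: Balaban1982Higgs1, (2.2) p.608] -/
theorem mlist_mem_box {x : Fin (dd P + 1) → ℤ} (hx : x ∈ Box (dd P) (P.L - 1) K (M2 P K₀)) :
    ∀ z ∈ mlist P.L K x, z ∈ Box (dd P) (P.L - 1) K (M2 P K₀) := by
  intro z hz
  have hb := mem_mlist_bounds P.hL x K z hz
  have hx' := (mem_boxDom.1 hx)
  refine mem_boxDom_of_between (u := clv P.L K x) ?_ hx hb.1 hb.2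
  rw [mem_boxDom]
  intro i
  have h0 : 0 ≤ clv P.L K x i := clv_nonneg P.hL K (fun i => (hx' i).1) i
  exact ⟨h0, lt_of_le_of_lt (clv_le P.hL K x i) (hx' i).2⟩

open Classical in
/-- **THE CONTOUR SYSTEM `Γ^{(K)}_{y,x}` OF THE CUBE ON THE LINEAGE'S CARRIER**: the composite contour (2.2) when `x ∈ B^K(y)`,
empty otherwise (start point: the block corner `baseEmb y = L^K·y`). [cite: Balaban1982Higgs1, (2.2) p.608] -/
def gammaT (P : HiggsLattice.Params) (K K₀ : ℕ) (y : ↥(boxDom (M2 P K₀))) (x : ↥(Box (dd P) (P.L - 1) K (M2 P K₀))) :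
    List ↥(Box (dd P) (P.L - 1) K (M2 P K₀)) :=
  if blk (nK P K) x.1 = y.1 then (mlist P.L K x.1).pmap Subtype.mk (mlist_mem_box x.2) else []

/-- `1 ≤ (L−1+1)^K`. [cite: Balaban1982Higgs1, (1.19) p.607] -/
theorem one_le_n (P : HiggsLattice.Params) (K : ℕ) : 1 ≤ (P.L - 1 + 1) ^ K := by
  rw [predL_succ]; exact Nat.one_le_pow _ _ P.hL

/-- When `x ∈ B^K(y)` the block corner `L^K·y` is `clv K x`. [cite: Balaban1982Higgs1, (2.2) p.608] -/
theorem baseEmb_eq_clv {y : ↥(boxDom (M2 P K₀))} {x : ↥(Box (dd P) (P.L - 1) K (M2 P K₀))}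
    (h : blk (nK P K) x.1 = y.1) : (baseEmb (one_le_n P K) (M2 P K₀) y).1 = clv P.L K x.1 := by
  funext i
  have := congrFun h i
  simp only [blk] at this
  show (((P.L - 1 + 1) ^ K : ℕ) : ℤ) * y.1 i = (P.L : ℤ) ^ K * (x.1 i / (P.L : ℤ) ^ K)
  rw [← this, predL_succ]; push_cast; rfl

/-- **hend**: `Γ^{(K)}_{y,x}` ends at `x`. [cite: Balaban1982Higgs1, (2.2) p.608] -/
theorem gammaT_end (y : ↥(boxDom (M2 P K₀))) (x : ↥(Box (dd P) (P.L - 1) K (M2 P K₀)))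
    (h : blk (nK P K) x.1 = y.1) : pathEnd (baseEmb (one_le_n P K) (M2 P K₀) y) (gammaT P K K₀ y x) = x := by
  unfold gammaT
  rw [if_pos h]
  apply Subtype.ext
  have hb : baseEmb (one_le_n P K) (M2 P K₀) y = ⟨clv P.L K x.1, by rw [← baseEmb_eq_clv h]; exact (baseEmb _ _ y).2⟩ :=
    Subtype.ext (baseEmb_eq_clv h)
  rw [hb, val_pathEnd_pmap, pathEnd_mlist P.hL]

/-- **hnn**: `Γ^{(K)}_{y,x}` is a nearest-neighbour path. [cite: Balaban1982Higgs1, (2.2) p.608] -/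
theorem gammaT_nn (y : ↥(boxDom (M2 P K₀))) (x : ↥(Box (dd P) (P.L - 1) K (M2 P K₀))) :
    PathRel (fun u v : ↥(Box (dd P) (P.L - 1) K (M2 P K₀)) => v.1 ∈ nbrs u.1)
      (baseEmb (one_le_n P K) (M2 P K₀) y) (gammaT P K K₀ y x) := by
  unfold gammaT
  by_cases h : blk (nK P K) x.1 = y.1
  · rw [if_pos h]
    have hb : baseEmb (one_le_n P K) (M2 P K₀) y = ⟨clv P.L K x.1, by rw [← baseEmb_eq_clv h]; exact (baseEmb _ _ y).2⟩ :=
      Subtype.ext (baseEmb_eq_clv h)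
    rw [hb]
    exact (pathRel_pmap_iff (r := fun a b : Fin (dd P + 1) → ℤ => b ∈ nbrs a) (mlist P.L K x.1) (clv P.L K x.1)
      _ _).2 (pathRel_mlist P.hL x.1 K)
  · rw [if_neg h]; trivial

/-- The length of `Γ^{(K)}_{y,x}` is at most `(d+1)(L^K − 1)`. [cite: Balaban1982Higgs1, (2.2) p.608] -/
theorem length_gammaT_le (y : ↥(boxDom (M2 P K₀))) (x : ↥(Box (dd P) (P.L - 1) K (M2 P K₀))) :
    ((gammaT P K K₀ y x).length : ℤ) ≤ ((dd P : ℤ) + 1) * ((P.L : ℤ) ^ K - 1) := by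
  unfold gammaT
  split_ifs
  · rw [List.length_pmap]; exact length_mlist_le P.hL x.1 K
  · simp only [List.length_nil, Nat.cast_zero]
    have : (1 : ℤ) ≤ (P.L : ℤ) ^ K := by exact_mod_cast Nat.one_le_pow _ _ P.hL
    have : (0 : ℤ) ≤ dd P := Nat.cast_nonneg _
    nlinarith

/-- **`A(Γ^{(K)}_{y,x})` ON THE LINEAGE'S CARRIER IS B1's `multiContourSum` ALONG THE CHART** (times the scale `σ`), for any
pair function whose forward bond values on `□` are `σ·Ã`. [cite: Balaban1982Higgs1, (2.2)–(2.3) p.608]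
[cite: Balaban1983RegularityDecay, (1.4) p.572] -/
theorem lsum_gammaT (hK : K ≤ P.K) (hS : ∀ μ, P.L ^ K ≤ P.sitesPerDir 0 μ) (j : Lab P K K₀) (At : HiggsLattice.VecField P 0) (σ : ℝ)
    (B : ↥(Box (dd P) (P.L - 1) K (M2 P K₀)) → ↥(Box (dd P) (P.L - 1) K (M2 P K₀)) → ℝ)
    (Bz : (Fin (dd P + 1) → ℤ) → (Fin (dd P + 1) → ℤ) → ℝ) (hBz : ∀ u v, B u v = Bz u.1 v.1)
    (hB : ∀ z ∈ Box (dd P) (P.L - 1) K (M2 P K₀), ∀ i, Bz z (z + e1 i) = σ * At ⟨toT K K₀ j z, castD P i⟩)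
    (y : ↥(boxDom (M2 P K₀))) (x : ↥(Box (dd P) (P.L - 1) K (M2 P K₀))) (h : blk (nK P K) x.1 = y.1) :
    lsum B (baseEmb (one_le_n P K) (M2 P K₀) y) (gammaT P K K₀ y x) = σ * multiContourSum At K (toT K K₀ j x.1) := by
  unfold gammaT
  rw [if_pos h]
  have hb : baseEmb (one_le_n P K) (M2 P K₀) y = ⟨clv P.L K x.1, by rw [← baseEmb_eq_clv h]; exact (baseEmb _ _ y).2⟩ :=
    Subtype.ext (baseEmb_eq_clv h)
  rw [hb]
  have hfun : B = fun u v => Bz u.1 v.1 := by funext u v; exact hBz u v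
  rw [hfun, lsum_pmap, lsum_mlist_eq_multiContourSum hK hS j At σ Bz x.1]
  intro z hz1 hz2 i
  refine hB z ?_ i
  have hx' := mem_boxDom.1 x.2
  refine mem_boxDom_of_between (u := clv P.L K x.1) ?_ x.2 hz1 hz2
  rw [mem_boxDom]
  exact fun i => ⟨clv_nonneg P.hL K (fun i => (hx' i).1) i, lt_of_le_of_lt (clv_le P.hL K x.1 i) (hx' i).2⟩

end System

end Literature.MathematicalPhysics.QuantumFieldTheory.Balaban1983to89.B1TorusCubeContours
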